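import Summits.QuantumFields.BalabanUV.T4Continuum.Support.B13AssemblyCoresEndRestrictRecord
import Summits.QuantumFields.BalabanUV.T4Continuum.Support.SubstrateSlotsOfRecordShift

/-!
# B13AssemblyCoresEndSubstrateShift — row O1-d2-ii «act instance», follower: THE (2.14)-FACTOR-CORE END OF RECORD **RE-POINTED TO THE
# SUBSTRATE's LEVEL-SHIFTED SLOTS OF RECORD** `SubstrateSlotsOfRecordShift.slotsOfRecordShift` (W-21 = L-E15; NE5 owner RULINGS R53 ∕ R54,
# located point F-ne5p1-g37-1, substrate-typer (ν1)) — the twin of this lineage's N184 `B13AssemblyCoresEndRestrictRecord` §2 ∕ §3 (p221018)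
# with `slotsOfRecord ↦ slotsOfRecordShift`; `hact` by `rfl`, the (2.14)-cores of record `coresRec` REUSED BY NAME (cell `pub-balaban`, T⁴
# fan-out, `HOME/BINDER-OWNERS.md` row NE5; unit `b2b-balaban-t4-ne5-formalise-leaf-08`, gen 13; journal INTENT l.20070)

HONEST FRAMING (T4-DAG PAGE 1).  Rung (B)+1 on ONE finite four-torus of fixed physical size — NOT infinite volume, NOT a mass gap, NOT
the Clay problem; `FlowStep.BetaPertH`, (B), (B^μ) do not occur here.  NE5 (`T4OutputRate.NE5`) is NOT PRINTED and NOT PROVED (spine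
0/9, unchanged): the END below is an IMPLICATION from displayed binders — «NE5 ⇐ the shifted instance» (trigger c5), NOT «NE5 proved».  The
O1 INSTANCE (and its level shift) is the SUBSTRATE cell's (Q-NE9-O1, DESIGN RULE R34, W-21); this file APPLIES a landed END face BY NAME at it
(CLAIM RULE 3 ∕ 7 (b): not re-wiring) and discharges NOTHING of the substrate's letters.  0 cite tags; printed KIND only; 0 `def`.
HONEST DEPENDENCY (cell, verbatim): continuum YM on T⁴ ⇐ BetaPertH ∧ nine spine estimates (0/9 proved); BetaPertH ⇐ (D1) ∧ (D4) ∧ CAP+tail;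
G-an2-4 gates asym, D1 and NE2/3/4.

WHY THE RE-POINT (owner R53 (1)–(3), R54 (1); a typing fact of the tree, nothing of print asserted).  At the UNSHIFTED `slotsOfRecord` both
runs' `.cov` slots read the covariance of record at the SAME depth `k` (they coincide at a common contour system, W-20 §4), so the W1 binder
`hwer` there compares same-depth species, and the W1 face PRODUCED from the owner's level-shifted readings (`ReadsTowerCovA` depth `k` ∧
`ReadsTowerCovB` depth `k+1`, `B13ReadingsDecay`) is jointly uninhabitable at that instance for any tower with a level step on a read entry
(at a common contour system; for distinct `ΓA ∕ ΓB` the step is forced to equal the contour-letter variation — located point F-ne5p1-g37-1,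
`HOME/CLAIMS.log` l.19772, and leaf-01-g18's kernel note K8″ l.19805).  Print pairs run A's step-`k` term with run B's step-`(k+1)` term at the same block lattice
([Balaban1987RG1] (2.3) p. 265, KIND), so the substrate RE-POINTED run B's `.cov` slot one level deeper — `slotsOfRecordShift` ((α) COV-ONLY,
R54 (1)) — and the E1 ENDs re-point to it (R54 (2)∕(4)).  THIS module is the cores road's re-pointed END at generic sub-slot `M`; the `measOp`
face and the W1-PRODUCED faces follow in their own modules once leaf-01's shifted letter lemmas and the substrate's L-E9b face land.

WHAT THIS MODULE IS (bookkeeping ∕ [folklore]; one `rfl` + two applications BY NAME; no estimate):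
* §1 `slotsOfRecordShift_act_eq_actOfCores` (`rfl`): the shift leaves the `act` slot untouched, so the END's `hact` is still `rfl` against
  N184's `coresRec … L` (imported BY NAME, not re-declared).
* §2 **`ne5_slotsOfRecordShift_cores_actNorm`** — leaf-04-g3's diamond `B13AssemblyCoresEndRestrict.ne5_of_record_cores_actNorm` AT
  `S₀ := slotsOfRecordShift …`, `𝔠 := coresRec …`, `hact := rfl`, `hwB := coresRec_wB_nonneg`; every other binder = N184 §2's VERBATIM with
  `slotsOfRecord ↦ slotsOfRecordShift` (generic sub-slot `M` with its two membership side conditions `hMA ∕ hMB`, the transport reading `hT`, the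
  slice budgets, levels L05∕L06 of the instance's outputs, W1 `hwer` in row NE2's entry currency + floor, W4, rooms, the factor letters in the
  substrate's currency on the sub-slot balls about run B's SHIFTED datum of record, history radius, `A′` ∕ decay split ∕ `Φ′`, sizes);
  conclusion LITERALLY `T4OutputRate.NE5 (B13StepOfRecord.outA (slotsOfRecordShift …) E₀ cB) (B13StepOfRecord.outB (slotsOfRecordShift …) E₀ cB)
  W κ θ′ C₅`, the diamond's `C₅` VERBATIM.
* §3 **`exists_ne5_slotsOfRecordShift_cores_actNorm`** — the chained face (arithmetic letters eliminated) the same way.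
CENSUS vs N184 §2 ∕ §3 (binders, by name): MINUS = ∅; PLUS = ∅; every binder's statement = N184's with `slotsOfRecord ↦ slotsOfRecordShift`
(run A's slots, `act`, `F`, `D`, margins are the SAME terms by W-21's `rfl` views; run B's raw slot is `rawBOfRecordShift`).
STATUS (census, Edison rule).  DISPLAYED at the shifted instance: everything listed under §2.  NOTHING of Bałaban's (2.14) data is asserted;
0/12 leaves; NE5 NOT PROVED; spine 0/9; rung (B)+1 finite T⁴; NOT infinite volume ∕ mass gap ∕ Clay.  0 sorry; axioms ⊆ {propext,
Classical.choice, Quot.sound}.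
-/

noncomputable section

open scoped BigOperators
open Metric MeasureTheory


namespace Summit.QuantumFields.BalabanUV.T4Continuum.B13AssemblyCoresEndSubstrateShift

open Literature.MathematicalPhysics.QuantumFieldTheory.Balaban1983to89
open Literature.MathematicalPhysics.QuantumFieldTheory.Balaban1983to89.T4OutputRate (Carriers Functional DecayBound NE5)
open Summit.QuantumFields.BalabanUV.T4Continuum.B13OpDatum (OpDatum)
open Summit.QuantumFields.BalabanUV.T4Continuum.B13OpDatumJunctions (opOf RawBounded WeightedEntrywiseRate)
open Summit.QuantumFields.BalabanUV.T4Continuum.B13StepTermLabels (TermIdx InnerLabel)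
open Summit.QuantumFields.BalabanUV.T4Continuum.B13InnerData (Bnd b13InnerData)
open Summit.QuantumFields.BalabanUV.T4Continuum.B13HistMeasurable (MeasPotFrame B13HistM)
open Summit.QuantumFields.BalabanUV.T4Continuum.B13TermCoreFamily (actOfCores factorCores)
open Summit.QuantumFields.BalabanUV.T4Continuum.B13TermCoreMass (factorMass)
open Summit.QuantumFields.BalabanUV.T4Continuum.UrsellTreeSum (ind)
open Summit.QuantumFields.BalabanUV.T4Continuum.UrsellTermBudget (actSum)
open Summit.QuantumFields.BalabanUV.T4Continuum.B13DomainGeometryTR (SCube footprint)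
open Summit.QuantumFields.BalabanUV.T4Continuum.B13StepOfRecord (Slots assembly step)
open Summit.QuantumFields.BalabanUV.T4Continuum.SubstrateTwoRunsDriven (DrivenRuns)
open Summit.QuantumFields.BalabanUV.T4Continuum.SubstrateSlotsOfRecord (SpeciesRec SlotLetters slotsOfRecord)
open Summit.QuantumFields.BalabanUV.T4Continuum.SubstrateSlotsOfRecordShift (slotsOfRecordShift)
open Summit.QuantumFields.BalabanUV.T4Continuum.B13AssemblyCoresEndRestrict (ne5_of_record_cores_actNorm exists_ne5_of_record_cores_actNorm)
open Summit.QuantumFields.BalabanUV.T4Continuum.B13AssemblyCoresEndRestrictRecord (coresRec coresRec_wB_nonneg)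

variable {G : Type} [GaugeGroup G] (D : DrivenRuns G)
variable {o : Type} [Fintype o] [DecidableEq o] (ι : G →* Matrix o o ℂ) (c : ℂ) (a : ℝ) (s : ℕ → ℂ)
variable {T ι' S Ω 𝒴 : Type} (P : MeasPotFrame D.carriers) {IOp : Type*}
  (𝒵 : D.carriers.Dom → InnerLabel D.carriers.Dom (Bnd D.toTwoRuns) → Type) [∀ Z j, Fintype (𝒵 Z j)] (dom : ∀ Z j, 𝒵 Z j → D.carriers.Dom)
  (Jc : D.carriers.Dom → InnerLabel D.carriers.Dom (Bnd D.toTwoRuns) → Type) [∀ Z j, Fintype (Jc Z j)]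
  (V : D.carriers.Dom → InnerLabel D.carriers.Dom (Bnd D.toTwoRuns) → Type) [∀ Z j, NormedAddCommGroup (V Z j)]
  [∀ Z j, InnerProductSpace ℝ (V Z j)] [∀ Z j, MeasurableSpace (V Z j)] [∀ Z j, BorelSpace (V Z j)] [∀ Z j, FiniteDimensional ℝ (V Z j)]
  (mI : D.carriers.Dom → InnerLabel D.carriers.Dom (Bnd D.toTwoRuns) → Type) [∀ Z j, Fintype (mI Z j)] [∀ Z j, DecidableEq (mI Z j)]
  (L : SlotLetters D (o := o) (T := T) (ι' := ι') (S := S) (Ω := Ω) (𝒴 := 𝒴) P (IOp := IOp) 𝒵 dom Jc V mI)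

/-! ## §1 The shift leaves the activity slot untouched (`rfl`) -/

/-- [folklore] **THE END's `hact` AT THE LEVEL-SHIFTED SLOTS OF RECORD IS `rfl`**: the (α) COV-ONLY shift changes run B's raw slot only; the
activity slot of `slotsOfRecordShift` IS `actOfCores` of N184's cores of record `coresRec`. -/
theorem slotsOfRecordShift_act_eq_actOfCores :
    (slotsOfRecordShift D ι c a s P 𝒵 dom Jc V mI L).act = actOfCores (coresRec D P 𝒵 dom Jc V mI L) := rfl

/-! ## §2 The diamond of record at the level-shifted slots of record -/

section End

variable (M : Submodule ℂ (OpDatum (SpeciesRec D o T ι' Ω 𝒴)))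
  (hMA : ∀ g W k, opOf (slotsOfRecordShift D ι c a s P 𝒵 dom Jc V mI L).F (slotsOfRecordShift D ι c a s P 𝒵 dom Jc V mI L).rawA g W k ∈ M)
  (hMB : ∀ g U k, opOf (slotsOfRecordShift D ι c a s P 𝒵 dom Jc V mI L).F (slotsOfRecordShift D ι c a s P 𝒵 dom Jc V mI L).rawB g U k ∈ M)
  (E₀ cB : ℝ)

include hMA in
/-- [folklore] **THE (2.14)-FACTOR-CORE END OF RECORD AT THE SUBSTRATE's LEVEL-SHIFTED SLOTS OF RECORD** (W-21 ∕ owner R53–R54: run B's `.cov`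
read ONE LEVEL DEEPER at the aligned index) — `B13AssemblyCoresEndRestrict.ne5_of_record_cores_actNorm` at `S₀ := slotsOfRecordShift …`,
`𝔠 := coresRec …`, `hact := rfl`, `hwB := coresRec_wB_nonneg`.  Binders (all DISPLAYED, in leaf-04-g3's order): the transport reading, the
slice budgets, the levels of the instance's outputs, W1 in row NE2's entry currency + floor, W4, rooms, the factor letters (= the substrate's
`gaussN ∕ gaussQ ∘ linForm` clauses on the sub-slot balls about run B's datum of record, by `coresRec_N ∕ _q`), the history radius, `A′` ∕ decay
split ∕ `Φ′`, sizes — N184 §2's list VERBATIM with `slotsOfRecord ↦ slotsOfRecordShift`.  Conclusion LITERALLY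
`T4OutputRate.NE5 (B13StepOfRecord.outA (slotsOfRecordShift …) E₀ cB) (B13StepOfRecord.outB (slotsOfRecordShift …) E₀ cB) W κ θ′ C₅`, SAME `C₅`.
«NE5 ⇐ the shifted instance» — NOT NE5 proved; no letter of the substrate discharged; here W1 (`hwer`) compares run A's depth-`k` species
with run B's depth-`(k+1)` covariance — rows NE2 ∧ NE3's two-level rate (R53 (3)), DISPLAYED. -/
theorem ne5_slotsOfRecordShift_cores_actNorm {W : Set (ℕ → ℝ)} {ROp RHist R' H : ℕ → ℝ}
    {N₀f mf bf : D.carriers.Dom → InnerLabel D.carriers.Dom (Bnd D.toTwoRuns) → ℝ}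
    {A' : ℕ → D.carriers.Dom → InnerLabel D.carriers.Dom (Bnd D.toTwoRuns) → ℝ}
    {mstar κ Φ' EA₀ E₁ cA c₁ r₀ δ' θ θ' ρ₀ B : ℝ} {k₀ : ℕ}
    (hT : (assembly (slotsOfRecordShift D ι c a s P 𝒵 dom Jc V mI L)).TransportReads W)
    (hbB : (assembly (slotsOfRecordShift D ι c a s P 𝒵 dom Jc V mI L)).SliceBudgetB W κ cB)
    (hbA : (slotsOfRecordShift D ι c a s P 𝒵 dom Jc V mI L).D.SliceBudget (step (slotsOfRecordShift D ι c a s P 𝒵 dom Jc V mI L) E₀ cB) W κ cA)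
    (hdA : DecayBound (B13StepOfRecord.outA (slotsOfRecordShift D ι c a s P 𝒵 dom Jc V mI L) E₀ cB) W EA₀ κ)
    (hdB : DecayBound (B13StepOfRecord.outB (slotsOfRecordShift D ι c a s P 𝒵 dom Jc V mI L) E₀ cB) W E₀ κ)
    (hRA : RawBounded (slotsOfRecordShift D ι c a s P 𝒵 dom Jc V mI L).F (assembly (slotsOfRecordShift D ι c a s P 𝒵 dom Jc V mI L)).rawAt W)
    (hRB : RawBounded (slotsOfRecordShift D ι c a s P 𝒵 dom Jc V mI L).F (slotsOfRecordShift D ι c a s P 𝒵 dom Jc V mI L).rawB W)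
    (hwer : WeightedEntrywiseRate (slotsOfRecordShift D ι c a s P 𝒵 dom Jc V mI L).F (assembly (slotsOfRecordShift D ι c a s P 𝒵 dom Jc V mI L)).rawAt
      (slotsOfRecordShift D ι c a s P 𝒵 dom Jc V mI L).rawB W c₁ fun k => θ ^ k)
    (hfl : ∀ k, r₀ ≤ (slotsOfRecordShift D ι c a s P 𝒵 dom Jc V mI L).rOp k)
    (hins : (step (slotsOfRecordShift D ι c a s P 𝒵 dom Jc V mI L) E₀ cB).InsertionRate W κ E₀ δ' θ)
    (hOp : ∀ k, (slotsOfRecordShift D ι c a s P 𝒵 dom Jc V mI L).rOp k ≤ ROp k) (hroom : ∀ k, ROp k < R' k)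
    (hHist : ∀ k, (assembly (slotsOfRecordShift D ι c a s P 𝒵 dom Jc V mI L)).bHist E₀ cB k + (slotsOfRecordShift D ι c a s P 𝒵 dom Jc V mI L).rHist k ≤
      RHist k)
    -- the factor letters in the substrate's currency (by `coresRec_N ∕ _q` these ARE `gaussN ∕ gaussQ ∘ linForm` clauses)
    (hm : 0 < mstar) (hmf : ∀ Z ℓ, mstar ≤ mf Z ℓ) (hN₀ : ∀ Z ℓ, 0 ≤ N₀f Z ℓ)
    (hNf : ∀ k, ∀ g ∈ W, ∀ (U : D.carriers.BgB) (X : D.carriers.Dom), D.carriers.scale X = k →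
      ∀ i, (assembly (slotsOfRecordShift D ι c a s P 𝒵 dom Jc V mI L)).𝒯.Rel k i X →
      ∀ m : Fin ((assembly (slotsOfRecordShift D ι c a s P 𝒵 dom Jc V mI L)).𝒯.len i + 1),
      (∀ op ∈ ball (⟨opOf (slotsOfRecordShift D ι c a s P 𝒵 dom Jc V mI L).F (slotsOfRecordShift D ι c a s P 𝒵 dom Jc V mI L).rawB g U k,
          hMB g U k⟩ : M) (R' k),
        AEStronglyMeasurable ((factorCores (assembly (slotsOfRecordShift D ι c a s P 𝒵 dom Jc V mI L)).𝒯 (coresRec D P 𝒵 dom Jc V mI L) i m).N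
          (op : OpDatum _)) (factorCores (assembly (slotsOfRecordShift D ι c a s P 𝒵 dom Jc V mI L)).𝒯 (coresRec D P 𝒵 dom Jc V mI L) i m).lam) ∧
      (∀ p, DifferentiableOn ℂ (fun op : M =>
          (factorCores (assembly (slotsOfRecordShift D ι c a s P 𝒵 dom Jc V mI L)).𝒯 (coresRec D P 𝒵 dom Jc V mI L) i m).N (op : OpDatum _) p)
        (ball (⟨opOf (slotsOfRecordShift D ι c a s P 𝒵 dom Jc V mI L).F (slotsOfRecordShift D ι c a s P 𝒵 dom Jc V mI L).rawB g U k,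
          hMB g U k⟩ : M) (R' k))) ∧
      (∀ op ∈ ball (⟨opOf (slotsOfRecordShift D ι c a s P 𝒵 dom Jc V mI L).F (slotsOfRecordShift D ι c a s P 𝒵 dom Jc V mI L).rawB g U k,
          hMB g U k⟩ : M) (R' k), ∀ p,
        ‖(factorCores (assembly (slotsOfRecordShift D ι c a s P 𝒵 dom Jc V mI L)).𝒯 (coresRec D P 𝒵 dom Jc V mI L) i m).N (op : OpDatum _) p‖ ≤
          N₀f ((assembly (slotsOfRecordShift D ι c a s P 𝒵 dom Jc V mI L)).𝒯.poly i m)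
            ((assembly (slotsOfRecordShift D ι c a s P 𝒵 dom Jc V mI L)).𝒯.lab i m)))
    (hqf : ∀ k, ∀ g ∈ W, ∀ (U : D.carriers.BgB) (X : D.carriers.Dom), D.carriers.scale X = k →
      ∀ i, (assembly (slotsOfRecordShift D ι c a s P 𝒵 dom Jc V mI L)).𝒯.Rel k i X →
      ∀ m : Fin ((assembly (slotsOfRecordShift D ι c a s P 𝒵 dom Jc V mI L)).𝒯.len i + 1),
      (∀ op ∈ ball (⟨opOf (slotsOfRecordShift D ι c a s P 𝒵 dom Jc V mI L).F (slotsOfRecordShift D ι c a s P 𝒵 dom Jc V mI L).rawB g U k,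
          hMB g U k⟩ : M) (R' k),
        AEStronglyMeasurable (Function.uncurry
          ((factorCores (assembly (slotsOfRecordShift D ι c a s P 𝒵 dom Jc V mI L)).𝒯 (coresRec D P 𝒵 dom Jc V mI L) i m).q (op : OpDatum _)))
          ((factorCores (assembly (slotsOfRecordShift D ι c a s P 𝒵 dom Jc V mI L)).𝒯 (coresRec D P 𝒵 dom Jc V mI L) i m).lam.prod volume)) ∧
      (∀ p v, DifferentiableOn ℂ (fun op : M =>
          (factorCores (assembly (slotsOfRecordShift D ι c a s P 𝒵 dom Jc V mI L)).𝒯 (coresRec D P 𝒵 dom Jc V mI L) i m).q (op : OpDatum _) p v)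
        (ball (⟨opOf (slotsOfRecordShift D ι c a s P 𝒵 dom Jc V mI L).F (slotsOfRecordShift D ι c a s P 𝒵 dom Jc V mI L).rawB g U k,
          hMB g U k⟩ : M) (R' k))) ∧
      (∀ op ∈ ball (⟨opOf (slotsOfRecordShift D ι c a s P 𝒵 dom Jc V mI L).F (slotsOfRecordShift D ι c a s P 𝒵 dom Jc V mI L).rawB g U k,
          hMB g U k⟩ : M) (R' k), ∀ p v,
        mf ((assembly (slotsOfRecordShift D ι c a s P 𝒵 dom Jc V mI L)).𝒯.poly i m) ((assembly (slotsOfRecordShift D ι c a s P 𝒵 dom Jc V mI L)).𝒯.lab i m) *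
            ‖v‖ ^ 2 -
          bf ((assembly (slotsOfRecordShift D ι c a s P 𝒵 dom Jc V mI L)).𝒯.poly i m) ((assembly (slotsOfRecordShift D ι c a s P 𝒵 dom Jc V mI L)).𝒯.lab i m) ≤
          ((factorCores (assembly (slotsOfRecordShift D ι c a s P 𝒵 dom Jc V mI L)).𝒯 (coresRec D P 𝒵 dom Jc V mI L) i m).q (op : OpDatum _) p v).re))
    (hH : ∀ k, ∀ g ∈ W, ∀ U : D.carriers.BgB, ‖(assembly (slotsOfRecordShift D ι c a s P 𝒵 dom Jc V mI L)).histRef g U k‖ + RHist k ≤ H k)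
    -- the stripped majorant's decay split and anchored exponential norm
    (hκ : 0 ≤ κ) (hA0' : ∀ k Z ℓ, 0 ≤ A' k Z ℓ)
    (hdec : ∀ k Z ℓ, factorMass (coresRec D P 𝒵 dom Jc V mI L) N₀f bf mstar (H k) Z ℓ ≤ A' k Z ℓ * Real.exp (-(κ * (D.carriers.d Z + 5))))
    (hΦ0 : 0 ≤ Φ') (hsmallΦ : 36 * Φ' < 1)
    (hΦ : ∀ (k : ℕ) (q : SCube D.toTwoRuns), ∑ Z ∈ D.toTwoRuns.domAt k,
      ind (q ∈ footprint Z) * actSum (b13InnerData D.toTwoRuns) (A' k) k Z * Real.exp ((footprint Z).card) ≤ Φ')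
    (hE₀ : 0 ≤ E₀) (hE₁ : 0 < E₁) (hcA : 0 ≤ cA) (hcB : 0 ≤ cB) (hc₁ : 0 ≤ c₁) (hr₀ : 0 < r₀) (hδ' : 0 ≤ δ')
    (hθ : 0 ≤ θ) (hθθ' : θ ≤ θ') (hθ'1 : θ' ≤ 1) (hω : 0 < (slotsOfRecordShift D ι c a s P 𝒵 dom Jc V mI L).D.ω)
    (hω1 : (slotsOfRecordShift D ι c a s P 𝒵 dom Jc V mI L).D.ω < 1) (hρ₀ : ρ₀ < 1)
    (hnear : (c₁ / r₀ + δ') * θ ^ k₀ + cA * (EA₀ + E₀) / (1 - (slotsOfRecordShift D ι c a s P 𝒵 dom Jc V mI L).D.ω) ≤ ρ₀) (hB : 0 ≤ B)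
    (hfirst : ∀ k < k₀, EA₀ + E₀ ≤ B * θ ^ k)
    (hsmall : (slotsOfRecordShift D ι c a s P 𝒵 dom Jc V mI L).D.ω + Φ' / (1 - 36 * Φ') / (1 - ρ₀) * cA < θ') :
    NE5 (B13StepOfRecord.outA (slotsOfRecordShift D ι c a s P 𝒵 dom Jc V mI L) E₀ cB)
      (B13StepOfRecord.outB (slotsOfRecordShift D ι c a s P 𝒵 dom Jc V mI L) E₀ cB) W κ θ'
      ((Φ' / (1 - 36 * Φ') / (1 - ρ₀) * (c₁ / r₀) + Φ' / (1 - 36 * Φ') / (1 - ρ₀) * δ' + B) *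
        (θ' - (slotsOfRecordShift D ι c a s P 𝒵 dom Jc V mI L).D.ω) /
        (θ' - ((slotsOfRecordShift D ι c a s P 𝒵 dom Jc V mI L).D.ω + Φ' / (1 - 36 * Φ') / (1 - ρ₀) * cA))) :=
  ne5_of_record_cores_actNorm (slotsOfRecordShift D ι c a s P 𝒵 dom Jc V mI L) M hMA hMB (coresRec D P 𝒵 dom Jc V mI L) E₀ cB rfl hT hbB hbA
    hdA hdB hRA hRB hwer hfl hins hOp hroom hHist hm hmf (coresRec_wB_nonneg D P 𝒵 dom Jc V mI L) hN₀ hNf hqf hH hκ hA0' hdec hΦ0 hsmallΦ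
    hΦ hE₀ hE₁ hcA hcB hc₁ hr₀ hδ' hθ hθθ' hθ'1 hω hω1 hρ₀ hnear hB hfirst hsmall

/-! ## §3 The chained face at the level-shifted slots of record -/

include hMA in
/-- [folklore] **THE CHAINED END OF RECORD AT THE SUBSTRATE's LEVEL-SHIFTED SLOTS OF RECORD** —
`B13AssemblyCoresEndRestrict.exists_ne5_of_record_cores_actNorm`
(arithmetic letters eliminated: `0 < θ < 1`, `cA(EA₀ + E₀) < 1 − ω`, `ω + (Φ′∕(1 − 36Φ′))·cA·(1 − ω)∕(1 − ω − cA(EA₀ + E₀)) < θ′`) at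
`S₀ := slotsOfRecordShift …`, `𝔠 := coresRec …`, `hact := rfl`, `hwB` discharged ⟹
`∃ C₅, NE5 (B13StepOfRecord.outA (slotsOfRecordShift …) E₀ cB) (B13StepOfRecord.outB (slotsOfRecordShift …) E₀ cB) W κ θ′ C₅`.
«NE5 ⇐ the shifted instance». -/
theorem exists_ne5_slotsOfRecordShift_cores_actNorm {W : Set (ℕ → ℝ)} {ROp RHist R' H : ℕ → ℝ}
    {N₀f mf bf : D.carriers.Dom → InnerLabel D.carriers.Dom (Bnd D.toTwoRuns) → ℝ}
    {A' : ℕ → D.carriers.Dom → InnerLabel D.carriers.Dom (Bnd D.toTwoRuns) → ℝ}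
    {mstar κ Φ' EA₀ cA c₁ r₀ δ' θ θ' : ℝ}
    (hT : (assembly (slotsOfRecordShift D ι c a s P 𝒵 dom Jc V mI L)).TransportReads W)
    (hbB : (assembly (slotsOfRecordShift D ι c a s P 𝒵 dom Jc V mI L)).SliceBudgetB W κ cB)
    (hbA : (slotsOfRecordShift D ι c a s P 𝒵 dom Jc V mI L).D.SliceBudget (step (slotsOfRecordShift D ι c a s P 𝒵 dom Jc V mI L) E₀ cB) W κ cA)
    (hdA : DecayBound (B13StepOfRecord.outA (slotsOfRecordShift D ι c a s P 𝒵 dom Jc V mI L) E₀ cB) W EA₀ κ)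
    (hdB : DecayBound (B13StepOfRecord.outB (slotsOfRecordShift D ι c a s P 𝒵 dom Jc V mI L) E₀ cB) W E₀ κ)
    (hRA : RawBounded (slotsOfRecordShift D ι c a s P 𝒵 dom Jc V mI L).F (assembly (slotsOfRecordShift D ι c a s P 𝒵 dom Jc V mI L)).rawAt W)
    (hRB : RawBounded (slotsOfRecordShift D ι c a s P 𝒵 dom Jc V mI L).F (slotsOfRecordShift D ι c a s P 𝒵 dom Jc V mI L).rawB W)
    (hwer : WeightedEntrywiseRate (slotsOfRecordShift D ι c a s P 𝒵 dom Jc V mI L).F (assembly (slotsOfRecordShift D ι c a s P 𝒵 dom Jc V mI L)).rawAt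
      (slotsOfRecordShift D ι c a s P 𝒵 dom Jc V mI L).rawB W c₁ fun k => θ ^ k)
    (hfl : ∀ k, r₀ ≤ (slotsOfRecordShift D ι c a s P 𝒵 dom Jc V mI L).rOp k)
    (hins : (step (slotsOfRecordShift D ι c a s P 𝒵 dom Jc V mI L) E₀ cB).InsertionRate W κ E₀ δ' θ)
    (hOp : ∀ k, (slotsOfRecordShift D ι c a s P 𝒵 dom Jc V mI L).rOp k ≤ ROp k) (hroom : ∀ k, ROp k < R' k)
    (hHist : ∀ k, (assembly (slotsOfRecordShift D ι c a s P 𝒵 dom Jc V mI L)).bHist E₀ cB k + (slotsOfRecordShift D ι c a s P 𝒵 dom Jc V mI L).rHist k ≤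
      RHist k)
    (hm : 0 < mstar) (hmf : ∀ Z ℓ, mstar ≤ mf Z ℓ) (hN₀ : ∀ Z ℓ, 0 ≤ N₀f Z ℓ)
    (hNf : ∀ k, ∀ g ∈ W, ∀ (U : D.carriers.BgB) (X : D.carriers.Dom), D.carriers.scale X = k →
      ∀ i, (assembly (slotsOfRecordShift D ι c a s P 𝒵 dom Jc V mI L)).𝒯.Rel k i X →
      ∀ m : Fin ((assembly (slotsOfRecordShift D ι c a s P 𝒵 dom Jc V mI L)).𝒯.len i + 1),
      (∀ op ∈ ball (⟨opOf (slotsOfRecordShift D ι c a s P 𝒵 dom Jc V mI L).F (slotsOfRecordShift D ι c a s P 𝒵 dom Jc V mI L).rawB g U k,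
          hMB g U k⟩ : M) (R' k),
        AEStronglyMeasurable ((factorCores (assembly (slotsOfRecordShift D ι c a s P 𝒵 dom Jc V mI L)).𝒯 (coresRec D P 𝒵 dom Jc V mI L) i m).N
          (op : OpDatum _)) (factorCores (assembly (slotsOfRecordShift D ι c a s P 𝒵 dom Jc V mI L)).𝒯 (coresRec D P 𝒵 dom Jc V mI L) i m).lam) ∧
      (∀ p, DifferentiableOn ℂ (fun op : M =>
          (factorCores (assembly (slotsOfRecordShift D ι c a s P 𝒵 dom Jc V mI L)).𝒯 (coresRec D P 𝒵 dom Jc V mI L) i m).N (op : OpDatum _) p)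
        (ball (⟨opOf (slotsOfRecordShift D ι c a s P 𝒵 dom Jc V mI L).F (slotsOfRecordShift D ι c a s P 𝒵 dom Jc V mI L).rawB g U k,
          hMB g U k⟩ : M) (R' k))) ∧
      (∀ op ∈ ball (⟨opOf (slotsOfRecordShift D ι c a s P 𝒵 dom Jc V mI L).F (slotsOfRecordShift D ι c a s P 𝒵 dom Jc V mI L).rawB g U k,
          hMB g U k⟩ : M) (R' k), ∀ p,
        ‖(factorCores (assembly (slotsOfRecordShift D ι c a s P 𝒵 dom Jc V mI L)).𝒯 (coresRec D P 𝒵 dom Jc V mI L) i m).N (op : OpDatum _) p‖ ≤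
          N₀f ((assembly (slotsOfRecordShift D ι c a s P 𝒵 dom Jc V mI L)).𝒯.poly i m)
            ((assembly (slotsOfRecordShift D ι c a s P 𝒵 dom Jc V mI L)).𝒯.lab i m)))
    (hqf : ∀ k, ∀ g ∈ W, ∀ (U : D.carriers.BgB) (X : D.carriers.Dom), D.carriers.scale X = k →
      ∀ i, (assembly (slotsOfRecordShift D ι c a s P 𝒵 dom Jc V mI L)).𝒯.Rel k i X →
      ∀ m : Fin ((assembly (slotsOfRecordShift D ι c a s P 𝒵 dom Jc V mI L)).𝒯.len i + 1),
      (∀ op ∈ ball (⟨opOf (slotsOfRecordShift D ι c a s P 𝒵 dom Jc V mI L).F (slotsOfRecordShift D ι c a s P 𝒵 dom Jc V mI L).rawB g U k,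
          hMB g U k⟩ : M) (R' k),
        AEStronglyMeasurable (Function.uncurry
          ((factorCores (assembly (slotsOfRecordShift D ι c a s P 𝒵 dom Jc V mI L)).𝒯 (coresRec D P 𝒵 dom Jc V mI L) i m).q (op : OpDatum _)))
          ((factorCores (assembly (slotsOfRecordShift D ι c a s P 𝒵 dom Jc V mI L)).𝒯 (coresRec D P 𝒵 dom Jc V mI L) i m).lam.prod volume)) ∧
      (∀ p v, DifferentiableOn ℂ (fun op : M =>
          (factorCores (assembly (slotsOfRecordShift D ι c a s P 𝒵 dom Jc V mI L)).𝒯 (coresRec D P 𝒵 dom Jc V mI L) i m).q (op : OpDatum _) p v)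
        (ball (⟨opOf (slotsOfRecordShift D ι c a s P 𝒵 dom Jc V mI L).F (slotsOfRecordShift D ι c a s P 𝒵 dom Jc V mI L).rawB g U k,
          hMB g U k⟩ : M) (R' k))) ∧
      (∀ op ∈ ball (⟨opOf (slotsOfRecordShift D ι c a s P 𝒵 dom Jc V mI L).F (slotsOfRecordShift D ι c a s P 𝒵 dom Jc V mI L).rawB g U k,
          hMB g U k⟩ : M) (R' k), ∀ p v,
        mf ((assembly (slotsOfRecordShift D ι c a s P 𝒵 dom Jc V mI L)).𝒯.poly i m) ((assembly (slotsOfRecordShift D ι c a s P 𝒵 dom Jc V mI L)).𝒯.lab i m) *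
            ‖v‖ ^ 2 -
          bf ((assembly (slotsOfRecordShift D ι c a s P 𝒵 dom Jc V mI L)).𝒯.poly i m) ((assembly (slotsOfRecordShift D ι c a s P 𝒵 dom Jc V mI L)).𝒯.lab i m) ≤
          ((factorCores (assembly (slotsOfRecordShift D ι c a s P 𝒵 dom Jc V mI L)).𝒯 (coresRec D P 𝒵 dom Jc V mI L) i m).q (op : OpDatum _) p v).re))
    (hH : ∀ k, ∀ g ∈ W, ∀ U : D.carriers.BgB, ‖(assembly (slotsOfRecordShift D ι c a s P 𝒵 dom Jc V mI L)).histRef g U k‖ + RHist k ≤ H k)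
    (hκ : 0 ≤ κ) (hA0' : ∀ k Z ℓ, 0 ≤ A' k Z ℓ)
    (hdec : ∀ k Z ℓ, factorMass (coresRec D P 𝒵 dom Jc V mI L) N₀f bf mstar (H k) Z ℓ ≤ A' k Z ℓ * Real.exp (-(κ * (D.carriers.d Z + 5))))
    (hΦ0 : 0 ≤ Φ') (hsmallΦ : 36 * Φ' < 1)
    (hΦ : ∀ (k : ℕ) (q : SCube D.toTwoRuns), ∑ Z ∈ D.toTwoRuns.domAt k,
      ind (q ∈ footprint Z) * actSum (b13InnerData D.toTwoRuns) (A' k) k Z * Real.exp ((footprint Z).card) ≤ Φ')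
    (hE₀ : 0 ≤ E₀) (hcA : 0 ≤ cA) (hcB : 0 ≤ cB) (hc₁ : 0 ≤ c₁) (hr₀ : 0 < r₀) (hδ' : 0 ≤ δ')
    (hθ0 : 0 < θ) (hθ1 : θ < 1) (hθθ' : θ ≤ θ') (hθ'1 : θ' ≤ 1) (hω : 0 < (slotsOfRecordShift D ι c a s P 𝒵 dom Jc V mI L).D.ω)
    (hω1 : (slotsOfRecordShift D ι c a s P 𝒵 dom Jc V mI L).D.ω < 1)
    (hh : cA * (EA₀ + E₀) < 1 - (slotsOfRecordShift D ι c a s P 𝒵 dom Jc V mI L).D.ω)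
    (hsmall : (slotsOfRecordShift D ι c a s P 𝒵 dom Jc V mI L).D.ω + Φ' / (1 - 36 * Φ') * cA * (1 - (slotsOfRecordShift D ι c a s P 𝒵 dom Jc V mI L).D.ω) /
      (1 - (slotsOfRecordShift D ι c a s P 𝒵 dom Jc V mI L).D.ω - cA * (EA₀ + E₀)) < θ') :
    ∃ C₅, NE5 (B13StepOfRecord.outA (slotsOfRecordShift D ι c a s P 𝒵 dom Jc V mI L) E₀ cB)
      (B13StepOfRecord.outB (slotsOfRecordShift D ι c a s P 𝒵 dom Jc V mI L) E₀ cB) W κ θ' C₅ :=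
  exists_ne5_of_record_cores_actNorm (slotsOfRecordShift D ι c a s P 𝒵 dom Jc V mI L) M hMA hMB (coresRec D P 𝒵 dom Jc V mI L) E₀ cB rfl hT
    hbB hbA hdA hdB hRA hRB hwer hfl hins hOp hroom hHist hm hmf (coresRec_wB_nonneg D P 𝒵 dom Jc V mI L) hN₀ hNf hqf hH hκ hA0' hdec hΦ0
    hsmallΦ hΦ hE₀ hcA hcB hc₁ hr₀ hδ' hθ0 hθ1 hθθ' hθ'1 hω hω1 hh hsmall

end End

end Summit.QuantumFields.BalabanUV.T4Continuum.B13AssemblyCoresEndSubstrateShift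

end
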